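import Summits.ValiantsHypothesis.ValiantsHypothesis.Theorems.LacunarySymmetroidMatrixDescartesVSQTriKit
import Summits.ValiantsHypothesis.ValiantsHypothesis.Theorems.LacunarySymmetroidMatrixDescartesVSQTriDesign
import Summits.ValiantsHypothesis.ValiantsHypothesis.Theorems.LacunarySymmetroidMatrixDescartesVSQPoints

/-!
# `MatrixDescartes` census, `m = 3` row — SIGNS of the tridiagonal determinant `E3` at the test points, I: helpers and level `0`

HONEST FRAMING.  Val-V1-extremal engine seat val-v1x-eng-6 (g2), `--supports stmt-ValiantsHypothesis-18050` (helper).  For the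
tridiagonal family of `…VSQTriDefs` (`K = n + 2 ≥ 4`, `B ≥ 16K²`; `P₀ = fa(t)`, `P₁ = (−1)^n fa(u)`, `P₂ = (−1)^n fc(u)`,
`Q₀ = B^{−δ} fb(t)`, `Q₁ = fb(u)`, `u = B^{−σ} t`) the sign of `E3 = P₀P₁P₂ − Q₀²P₂ − Q₁²P₀` at every test point, family by
family: level `0` (`P₀`'s chain, `Q₀`'s strong window and bracketed zeros — `sign3_L0U`, `sign3_L0W`, `sign3_L0I`), level `1`
(the same for `P₁, Q₁` while `P₀` sits on its top term and the finished link `0` is weak — `sign3_L1U`, `sign3_L1W`, `sign3_L1I`),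
level `2` (`P₂`'s chain — `sign3_L2`; levels `1` and `2` are in part II, `…VSQTriPoints1`).  Each is ONE application of the pure-real rules `U3_real` / `W3_real` (`…VSQTriKit`) to
certificates produced by the `m = 2` machinery (`…VSQKit`, `…VSQDesign`, `…VSQPoints`) and the shifted bookkeeping `…VSQTriDesign`.
The count is assembled in `…VSQTriLaw`.  Nothing here bears on the crux `MatrixDescartes` (stmt-18050, asymptotic) or on `VP ≠ VNP`.
[folklore] Viro patchworking / dominance; intermediate value theorem.
-/

set_option linter.dupNamespace false
set_option autoImplicit false

namespace Summit.ValiantsHypothesis.ValiantsHypothesis.Theorems.LacunarySymmetroidMatrixDescartes.VSQ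

open scoped BigOperators
open Finset

variable {n : ℕ} {B : ℝ}

/-! ## 0. Small helpers -/

/-- `B ≥ 16K²` gives `B > 1`, `B ≥ 8K`, `B ≥ 4K²`. [folklore] -/
theorem hB16 (hB : 16 * ((n + 2 : ℕ) : ℝ) ^ 2 ≤ B) :
    1 < B ∧ 8 * ((n + 2 : ℕ) : ℝ) ≤ B ∧ 4 * ((n + 2 : ℕ) : ℝ) ^ 2 ≤ B := by
  have h1 : (2 : ℝ) ≤ ((n + 2 : ℕ) : ℝ) := by exact_mod_cast (show 2 ≤ n + 2 by omega)
  refine ⟨by nlinarith, by nlinarith, by nlinarith⟩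

/-- `|(−1)^n| = 1`. [folklore] -/
theorem abs_neg_one_pow' (n : ℕ) : |(-1 : ℝ) ^ n| = 1 := by simp

/-- a unit sign factor keeps a certificate. [folklore] -/
theorem cert_smul {g P s V : ℝ} (hg : |g| = 1) (h : |P - s * V| ≤ V / 8) : |g * P - (g * s) * V| ≤ V / 8 := by
  rw [show g * P - g * s * V = g * (P - s * V) by ring, abs_mul, hg, one_mul]; exact h

/-- a positive scalar rescales a certificate. [folklore] -/
theorem cert_zsmul {c P s V : ℝ} (hc : 0 < c) (h : |P - s * V| ≤ V / 8) : |c * P - s * (c * V)| ≤ (c * V) / 8 := by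
  rw [show c * P - s * (c * V) = c * (P - s * V) by ring, abs_mul, abs_of_pos hc]
  have := mul_le_mul_of_nonneg_left h hc.le
  linarith

/-- a unit sign factor keeps a bound. [folklore] -/
theorem abs_smul_le {g P p : ℝ} (hg : |g| = 1) (h : |P| ≤ p) : |g * P| ≤ p := by
  rw [abs_mul, hg, one_mul]; exact h

/-- a positive scalar rescales a bound. [folklore] -/
theorem abs_zsmul_le {c P p : ℝ} (hc : 0 < c) (h : |P| ≤ p) : |c * P| ≤ c * p := by
  rw [abs_mul, abs_of_pos hc]; exact mul_le_mul_of_nonneg_left h hc.le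

/-- `|s^a| = 1`, `Fin`-indexed. [folklore] -/
theorem abs_saF_eq (l : Fin (n + 2)) : |saF n l| = 1 := abs_saR_eq n l
/-- `|s^c| = 1`, `Fin`-indexed. [folklore] -/
theorem abs_scF_eq (l : Fin (n + 2)) : |scF n l| = 1 := abs_scR_eq n l

/-- term sizes at `B`-powers, `a`. [folklore] -/
theorem tv_ea (hB0 : 0 < B) (l : Fin (n + 2)) (x : ℤ) : tv B (haF n l) (dF n l) (B ^ x) = B ^ (ea n l x) :=
  tv_zpow hB0 _ _ _
/-- term sizes at `B`-powers, `b`. [folklore] -/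
theorem tv_eb (hB0 : 0 < B) (l : Fin (n + 2)) (x : ℤ) : tv B (hbF n l) (dF n l) (B ^ x) = B ^ (eb n l x) :=
  tv_zpow hB0 _ _ _
/-- term sizes at `B`-powers, `c`. [folklore] -/
theorem tv_ec (hB0 : 0 < B) (l : Fin (n + 2)) (x : ℤ) : tv B (hcF n l) (dF n l) (B ^ x) = B ^ (ec n l x) :=
  tv_zpow hB0 _ _ _

/-- `σ = 4n + 4` as an integer. [folklore] -/
theorem sg_cast (n : ℕ) : (sg n : ℤ) = 4 * n + 4 := by unfold sg; push_cast; ring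

/-- `B^{−σ} B^x = B^{x − σ}`. [folklore] -/
theorem u_zpow (hB0 : 0 < B) (x : ℤ) : B ^ (-(sg n : ℤ)) * B ^ x = B ^ (x - sg n) := by
  rw [← zpow_add₀ hB0.ne']; congr 1; ring

/-- rescaling the `b`-bound: `B^{−δ}(K B^E) = K B^{E − δ}`. [folklore] -/
theorem q0_reshape (hB0 : 0 < B) (E : ℤ) :
    B ^ (-(dlt n : ℤ)) * (((n + 2 : ℕ) : ℝ) * B ^ E) = ((n + 2 : ℕ) : ℝ) * B ^ (E - dlt n) := by
  rw [zpow_sub₀ hB0.ne', zpow_neg, div_eq_mul_inv]; ring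

/-- `a_0` dominates `a` on `(0, B^y]`, `y ≤ −1`. [folklore] -/
theorem domA_low (hn : 2 ≤ n) (hB : 16 * ((n + 2 : ℕ) : ℝ) ^ 2 ≤ B) {u : ℝ} {y : ℤ} (hu : 0 < u) (huy : u ≤ B ^ y)
    (hy : y ≤ -1) : Dom B (saF n) (haF n) (dF n) u 0 := by
  obtain ⟨hB1, -, -⟩ := hB16 hB
  have hB0 : 0 < B := lt_trans zero_lt_one hB1
  have D := dom_zpow hB1 (saF n) (haF n) (dF n) y 0
    (fun l hl => Or.inr (ea_low_dom' hn (Nat.one_le_iff_ne_zero.2 fun h => hl (Fin.ext h)) (val_le l) hy))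
  intro l hl
  rcases D l hl with h0 | H
  · exact Or.inl h0
  · exact Or.inr (dom_mono_left hB0 ((dF_strictMono (by omega)).monotone (Fin.zero_le _)) hu huy H)

/-- `c_0` dominates `c` on `(0, B^y]`, `y ≤ 4n + 3`. [folklore] -/
theorem domC_low (hn : 2 ≤ n) (hB : 16 * ((n + 2 : ℕ) : ℝ) ^ 2 ≤ B) {u : ℝ} {y : ℤ} (hu : 0 < u) (huy : u ≤ B ^ y)
    (hy : y ≤ 4 * (n : ℤ) + 3) : Dom B (scF n) (hcF n) (dF n) u 0 := by
  obtain ⟨hB1, -, -⟩ := hB16 hB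
  have hB0 : 0 < B := lt_trans zero_lt_one hB1
  have D := dom_zpow hB1 (scF n) (hcF n) (dF n) y 0
    (fun l hl => Or.inr (ec_low_dom hn (Nat.one_le_iff_ne_zero.2 fun h => hl (Fin.ext h)) (val_le l) hy))
  intro l hl
  rcases D l hl with h0 | H
  · exact Or.inl h0
  · exact Or.inr (dom_mono_left hB0 ((dF_strictMono (by omega)).monotone (Fin.zero_le _)) hu huy H)

/-- `a_{n+1}` dominates `a` on `[B^x, ∞)`, `x ≥ 4n + 3`. [folklore] -/
theorem domA_top (hn : 2 ≤ n) (hB : 16 * ((n + 2 : ℕ) : ℝ) ^ 2 ≤ B) {t : ℝ} {x : ℤ} (hx : 4 * (n : ℤ) + 3 ≤ x)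
    (ht : B ^ x ≤ t) : Dom B (saF n) (haF n) (dF n) t (Fin.last (n + 1)) := by
  obtain ⟨hB1, -, -⟩ := hB16 hB
  have hB0 : 0 < B := lt_trans zero_lt_one hB1
  have D := dom_zpow hB1 (saF n) (haF n) (dF n) x (Fin.last (n + 1))
    (fun l hl => Or.inr (ea_top_dom hn (by
        have := val_le l
        have hne : (l : ℕ) ≠ n + 1 := fun h => hl (Fin.ext (by simp [h]))
        omega) hx))
  intro l hl
  rcases D l hl with h0 | H
  · exact Or.inl h0
  · exact Or.inr (dom_mono_right hB0 ((dF_strictMono (by omega)).monotone (Fin.le_last l)) (zpow_pos hB0 _) ht H)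

/-- `b`-terms below the block-top term `b_n` at `B^x`, `x ≥ 4n − 1`, as a `Below` bound valid on `(0, B^x]`. [folklore] -/
theorem belowB_high (hB : 16 * ((n + 2 : ℕ) : ℝ) ^ 2 ≤ B) {t : ℝ} {x : ℤ} (hx : 4 * (n : ℤ) - 1 ≤ x) (ht0 : 0 ≤ t)
    (ht : t ≤ B ^ x) : Below B (sbF n) (hbF n) (dF n) t (B ^ (eb n n x)) := by
  obtain ⟨hB1, -, -⟩ := hB16 hB
  have hB0 : 0 < B := lt_trans zero_lt_one hB1
  exact below_mono hB0 ht0 ht (below_zpow hB1 _ _ _ x _ (Hb_high x hx))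

/-- `b`-terms below `b_1` at `B^y`, `y ≤ 2n + 1`, as a `Below` bound valid on `(0, B^y]`. [folklore] -/
theorem belowB_low (hB : 16 * ((n + 2 : ℕ) : ℝ) ^ 2 ≤ B) {t : ℝ} {y : ℤ} (hy : y ≤ 2 * (n : ℤ) + 1) (ht0 : 0 ≤ t)
    (ht : t ≤ B ^ y) : Below B (sbF n) (hbF n) (dF n) t (B ^ (eb n 1 y)) := by
  obtain ⟨hB1, -, -⟩ := hB16 hB
  have hB0 : 0 < B := lt_trans zero_lt_one hB1
  exact below_mono hB0 ht0 ht (below_zpow hB1 _ _ _ y _ (Hb_low y hy))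

/-- constants: `tv (a_0) u = B^{qa}`, `tv (c_0) u = B^{4(n+1)²}`. [folklore] -/
theorem tv_consts (B u : ℝ) :
    tv B (haF n 0) (dF n 0) u = B ^ (qa n) ∧ tv B (hcF n 0) (dF n 0) u = B ^ (4 * ((n : ℤ) + 1) ^ 2) := by
  have hd : dF n 0 = 0 := by simp [dF, dN]
  constructor
  · unfold tv; rw [hd, pow_zero, mul_one]; show B ^ (haN n 0) = _; rw [haN_zero]
  · unfold tv; rw [hd, pow_zero, mul_one]; show B ^ (hcN n 0) = _; rw [hcN_zero]

/-! ## 1. Level 0 -/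

/-- **level 0, U-points** (`x ≤ 2n − 1`, `a_{la}` dominant, link `0` weak): sign `s^a_{la} · 1 · (−1)^n`-type. [folklore] -/
theorem sign3_L0U (hn : 2 ≤ n) (hB : 16 * ((n + 2 : ℕ) : ℝ) ^ 2 ≤ B) {x : ℤ} (hx : x ≤ 2 * (n : ℤ) - 1) (la : Fin (n + 2))
    (Ha : ∀ l : Fin (n + 2), l ≠ la → ea n l x + 1 ≤ ea n la x) (Hgap : 2 * (eb n 1 x - dlt n) + 1 ≤ ea n la x + qa n) :
    0 < (saF n la * ((-1) ^ n * saF n 0) * ((-1) ^ n * scF n 0)) * E3 n B (B ^ x) := by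
  obtain ⟨hB1, h8, -⟩ := hB16 hB
  have hB0 : 0 < B := lt_trans zero_lt_one hB1
  have hn' : (2 : ℤ) ≤ n := by exact_mod_cast hn
  set y : ℤ := x - sg n with hy
  have hy1 : y ≤ -1 := by rw [hy, sg_cast]; linarith
  have htx : (0 : ℝ) < B ^ x := zpow_pos hB0 _
  have hty : (0 : ℝ) < B ^ y := zpow_pos hB0 _
  unfold E3
  rw [u_zpow hB0]
  have cP0 := cert_of_dom h8 hB0 (fun l => abs_saR_le n l) (haF n) (dF n) htx la
    (dom_zpow hB1 _ _ _ x la fun l hl => Or.inr (Ha l hl))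
  have cP1 := cert_smul (abs_neg_one_pow' n) (cert_of_dom h8 hB0 (fun l => abs_saR_le n l) (haF n) (dF n) hty 0
    (domA_low hn hB hty le_rfl hy1))
  have cP2 := cert_smul (abs_neg_one_pow' n) (cert_of_dom h8 hB0 (fun l => abs_scR_le n l) (hcF n) (dF n) hty 0
    (domC_low hn hB hty le_rfl (by linarith)))
  have bQ0 := abs_zsmul_le (zpow_pos hB0 (-(dlt n : ℤ))) (abs_bnom_le hB0 (fun l => abs_sbR_le n l) (hbF n) (dF n) htx
    (zpow_pos hB0 _).le (belowB_low hB (y := x) (by linarith) htx.le le_rfl))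
  have bQ1 := abs_bnom_le hB0 (fun l => abs_sbR_le n l) (hbF n) (dF n) hty (zpow_pos hB0 _).le
    (belowB_low hB (y := y) (by linarith) hty.le le_rfl)
  have g0 : 16 * (B ^ (-(dlt n : ℤ)) * (((n + 2 : ℕ) : ℝ) * B ^ (eb n 1 x))) ^ 2 ≤
      tv B (haF n la) (dF n la) (B ^ x) * tv B (haF n 0) (dF n 0) (B ^ y) := by
    rw [q0_reshape hB0, tv_ea hB0, tv_ea hB0]
    exact pow_gap16 hB1 hB (by have := ea_zero n y; simp only [Fin.val_zero] at this ⊢; linarith)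
  have g1 : 16 * (((n + 2 : ℕ) : ℝ) * B ^ (eb n 1 y)) ^ 2 ≤ tv B (haF n 0) (dF n 0) (B ^ y) * tv B (hcF n 0) (dF n 0) (B ^ y) := by
    rw [tv_ea hB0, tv_ec hB0]
    exact pow_gap16 hB1 hB (by
      have h1 := ea_zero n y; have h2 := ec_zero n y; have h3 := gap1_early hn hy1
      simp only [Fin.val_zero] at h1 h2 ⊢; linarith)
  have hs1 : |(-1 : ℝ) ^ n * saF n 0| = 1 := by rw [abs_mul, abs_neg_one_pow', abs_saF_eq, one_mul]
  have hs2 : |(-1 : ℝ) ^ n * scF n 0| = 1 := by rw [abs_mul, abs_neg_one_pow', abs_scF_eq, one_mul]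
  exact U3_real (tv_pos hB0 _ _ htx) (tv_pos hB0 _ _ hty) (tv_pos hB0 _ _ hty) (abs_saR_eq n la) hs1 hs2
    cP0 cP1 cP2 bQ0 bQ1 g0 g1

/-- **level 0, W-points** `x = 2n + 2w − 1` (link `0` strong): sign `−(−1)^n · s^c_0`. [folklore] -/
theorem sign3_L0W (hn : 2 ≤ n) (hB : 16 * ((n + 2 : ℕ) : ℝ) ^ 2 ≤ B) {w : ℕ} (hw1 : 1 ≤ w) (hwn : w ≤ n) :
    0 < -((-1) ^ n * scF n 0) * E3 n B (B ^ (2 * (n : ℤ) + 2 * w - 1)) := by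
  obtain ⟨hB1, h8, -⟩ := hB16 hB
  have hB0 : 0 < B := lt_trans zero_lt_one hB1
  have hn' : (2 : ℤ) ≤ n := by exact_mod_cast hn
  have hw1' : (1 : ℤ) ≤ w := by exact_mod_cast hw1
  have hwn' : (w : ℤ) ≤ n := by exact_mod_cast hwn
  set x : ℤ := 2 * (n : ℤ) + 2 * w - 1 with hx
  set y : ℤ := x - sg n with hy
  have hy1 : y ≤ -1 := by rw [hy, hx, sg_cast]; linarith
  have htx : (0 : ℝ) < B ^ x := zpow_pos hB0 _
  have hty : (0 : ℝ) < B ^ y := zpow_pos hB0 _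
  unfold E3
  rw [u_zpow hB0]
  -- strong link certificate
  have hsw : |sbF n ⟨w, by omega⟩| = 1 := by show |sbR n w| = 1; exact abs_sbR_blk hw1 hwn
  have cQ0 := cert_zsmul (zpow_pos hB0 (-(dlt n : ℤ))) (cert_of_dom h8 hB0 (fun l => abs_sbR_le n l) (hbF n) (dF n) htx
    ⟨w, by omega⟩ (dom_zpow hB1 _ _ _ x ⟨w, by omega⟩ fun l hl => by
      rcases cases_v (val_le l) with h0 | ⟨h1, h2⟩ | htop
      · exact Or.inl (sbR_off (Or.inl h0))
      · exact Or.inr (eb_blk_dom hw1 hwn h1 h2 (fun h => hl (Fin.ext h)))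
      · exact Or.inl (sbR_off (Or.inr htop))))
  have cP2 := cert_smul (abs_neg_one_pow' n) (cert_of_dom h8 hB0 (fun l => abs_scR_le n l) (hcF n) (dF n) hty 0
    (domC_low hn hB hty le_rfl (by linarith)))
  -- bounds
  have bP0 := abs_bnom_le hB0 (fun l => abs_saR_le n l) (haF n) (dF n) htx (zpow_pos hB0 (ea n n x)).le
    (below_zpow hB1 _ _ _ x _ fun l => Or.inr (by
      change ea n l x ≤ ea n n x
      by_cases hl : (l : ℕ) = n
      · rw [hl]
      · linarith [ea_n_dom hn hw1 hwn (val_le l) hl]))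
  have bP1 := abs_smul_le (abs_neg_one_pow' n) (abs_bnom_le hB0 (fun l => abs_saR_le n l) (haF n) (dF n) hty
    (zpow_pos hB0 (qa n)).le (below_zpow hB1 _ _ _ y _ fun l => Or.inr (ea_le_qa hn hy1 l)))
  have bQ1 := abs_bnom_le hB0 (fun l => abs_sbR_le n l) (hbF n) (dF n) hty (zpow_pos hB0 _).le
    (belowB_low hB (y := y) (by linarith) hty.le le_rfl)
  -- gaps
  have gs : 16 * ((((n + 2 : ℕ) : ℝ) * B ^ (ea n n x)) * (((n + 2 : ℕ) : ℝ) * B ^ (qa n))) ≤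
      (B ^ (-(dlt n : ℤ)) * tv B (hbF n ⟨w, by omega⟩) (dF n ⟨w, by omega⟩) (B ^ x)) ^ 2 := by
    rw [tv_eb hB0, ← zpow_add₀ hB0.ne', show -(dlt n : ℤ) + eb n (⟨w, by omega⟩ : Fin (n + 2)) x = eb n w x - dlt n by
      ring]
    exact pow_gap16' hB1 hB (by linarith [gap0_W hn hw1 hwn])
  have gw : 16 * (((n + 2 : ℕ) : ℝ) * B ^ (eb n 1 y)) ^ 2 ≤ (((n + 2 : ℕ) : ℝ) * B ^ (qa n)) * tv B (hcF n 0) (dF n 0) (B ^ y) := by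
    rw [tv_ec hB0]
    have hK1 : (1 : ℝ) ≤ ((n + 2 : ℕ) : ℝ) := by exact_mod_cast (show 1 ≤ n + 2 by omega)
    calc 16 * (((n + 2 : ℕ) : ℝ) * B ^ (eb n 1 y)) ^ 2 ≤ B ^ (qa n) * B ^ (ec n (0 : Fin (n + 2)) y) :=
          pow_gap16 hB1 hB (by have h2 := ec_zero n y; have h3 := gap1_early hn hy1; simp only [Fin.val_zero] at h2 ⊢; linarith)
      _ ≤ (((n + 2 : ℕ) : ℝ) * B ^ (qa n)) * B ^ (ec n (0 : Fin (n + 2)) y) := by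
          refine mul_le_mul_of_nonneg_right (le_mul_of_one_le_left (zpow_pos hB0 _).le hK1) (zpow_pos hB0 _).le
  have hs2 : |(-1 : ℝ) ^ n * scF n 0| = 1 := by rw [abs_mul, abs_neg_one_pow', abs_scF_eq, one_mul]
  have h := W3_real (mul_pos (zpow_pos hB0 _) (tv_pos hB0 _ _ htx)) (tv_pos hB0 _ _ hty) hsw hs2 cQ0 cP2 bP0 bP1 bQ1
    (by positivity) gs gw
  have e : -((-1 : ℝ) ^ n * scF n 0) *
      (fa n B (B ^ x) * ((-1) ^ n * fa n B (B ^ y)) * ((-1) ^ n * fc n B (B ^ y)) -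
        (B ^ (-(dlt n : ℤ)) * fb n B (B ^ x)) ^ 2 * ((-1) ^ n * fc n B (B ^ y)) - fb n B (B ^ y) ^ 2 * fa n B (B ^ x)) =
      ((-1 : ℝ) ^ n * scF n 0) * ((B ^ (-(dlt n : ℤ)) * fb n B (B ^ x)) ^ 2 * ((-1) ^ n * fc n B (B ^ y)) +
        fb n B (B ^ y) ^ 2 * fa n B (B ^ x) - fa n B (B ^ x) * ((-1) ^ n * fa n B (B ^ y)) * ((-1) ^ n * fc n B (B ^ y))) := by
    ring
  rw [e]
  exact h

/-- **level 0, bracketed zero of `Q₀`** (`b(t) = 0`, `B^{2n+2w−1} ≤ t ≤ B^{2n+2w+1}`): sign `s^a_n · 1 · (−1)^n`-type. [folklore] -/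
theorem sign3_L0I (hn : 2 ≤ n) (hB : 16 * ((n + 2 : ℕ) : ℝ) ^ 2 ≤ B) {w : ℕ} (hw1 : 1 ≤ w) (hwn : w + 1 ≤ n) {t : ℝ}
    (ht1 : B ^ (2 * (n : ℤ) + 2 * w - 1) ≤ t) (ht2 : t ≤ B ^ (2 * (n : ℤ) + 2 * (w + 1 : ℕ) - 1)) (hb : fb n B t = 0) :
    0 < (saF n ⟨n, by omega⟩ * ((-1) ^ n * saF n 0) * ((-1) ^ n * scF n 0)) * E3 n B t := by
  obtain ⟨hB1, h8, hB4⟩ := hB16 hB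
  have hB0 : 0 < B := lt_trans zero_lt_one hB1
  have hn' : (2 : ℤ) ≤ n := by exact_mod_cast hn
  have hwn' : (w : ℤ) + 1 ≤ n := by exact_mod_cast hwn
  have ht0 : 0 < t := lt_of_lt_of_le (zpow_pos hB0 _) ht1
  set x2 : ℤ := 2 * (n : ℤ) + 2 * (w + 1 : ℕ) - 1 with hx2
  set y2 : ℤ := x2 - sg n with hy2
  have hy2' : y2 ≤ -1 := by rw [hy2, hx2, sg_cast]; push_cast; linarith
  set u : ℝ := B ^ (-(sg n : ℤ)) * t with hu
  have hu0 : 0 < u := mul_pos (zpow_pos hB0 _) ht0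
  have huy : u ≤ B ^ y2 := by
    rw [hu, hy2, show x2 - sg n = -(sg n : ℤ) + x2 by ring, zpow_add₀ hB0.ne']
    exact mul_le_mul_of_nonneg_left ht2 (zpow_pos hB0 _).le
  unfold E3
  have cP0 := cert_of_dom h8 hB0 (fun l => abs_saR_le n l) (haF n) (dF n) ht0 ⟨n, by omega⟩
    (domA_bracket hn hB4 hw1 hwn ht1 ht2)
  have cP1 := cert_smul (abs_neg_one_pow' n) (cert_of_dom h8 hB0 (fun l => abs_saR_le n l) (haF n) (dF n) hu0 0
    (domA_low hn hB hu0 huy hy2'))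
  have cP2 := cert_smul (abs_neg_one_pow' n) (cert_of_dom h8 hB0 (fun l => abs_scR_le n l) (hcF n) (dF n) hu0 0
    (domC_low hn hB hu0 huy (by linarith)))
  have bQ0 : |B ^ (-(dlt n : ℤ)) * fb n B t| ≤ 0 := by rw [hb, mul_zero, abs_zero]
  have bQ1 := abs_bnom_le hB0 (fun l => abs_sbR_le n l) (hbF n) (dF n) hu0 (zpow_pos hB0 _).le
    (belowB_low hB (y := y2) (by linarith) hu0.le huy)
  have g0 : 16 * (0 : ℝ) ^ 2 ≤ tv B (haF n ⟨n, by omega⟩) (dF n ⟨n, by omega⟩) t * tv B (haF n 0) (dF n 0) u := by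
    have := mul_pos (tv_pos hB0 (haF n ⟨n, by omega⟩) (dF n ⟨n, by omega⟩) ht0) (tv_pos hB0 (haF n 0) (dF n 0) hu0)
    simpa using this.le
  have g1 : 16 * (((n + 2 : ℕ) : ℝ) * B ^ (eb n 1 y2)) ^ 2 ≤ tv B (haF n 0) (dF n 0) u * tv B (hcF n 0) (dF n 0) u := by
    obtain ⟨e1, e2⟩ := tv_consts (n := n) B u
    rw [e1, e2]
    exact pow_gap16 hB1 hB (by linarith [gap1_early hn hy2'])
  have hs1 : |(-1 : ℝ) ^ n * saF n 0| = 1 := by rw [abs_mul, abs_neg_one_pow', abs_saF_eq, one_mul]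
  have hs2 : |(-1 : ℝ) ^ n * scF n 0| = 1 := by rw [abs_mul, abs_neg_one_pow', abs_scF_eq, one_mul]
  exact U3_real (tv_pos hB0 _ _ ht0) (tv_pos hB0 _ _ hu0) (tv_pos hB0 _ _ hu0) (abs_saR_eq n _) hs1 hs2
    cP0 cP1 cP2 bQ0 bQ1 g0 g1

end Summit.ValiantsHypothesis.ValiantsHypothesis.Theorems.LacunarySymmetroidMatrixDescartes.VSQ
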